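import Summits.QuantumFields.YangMills.Theorems.SourcedPressureJensenSourcedPressureIncrementGaussFirstCumulant
import HarnessLib

/-!
# Sextic Wick moments of the Gaussian field of a kernel, and the free lattice-contact value `E[(X²−K_ss)²(Y²−K_tt)] = 8K_ssK_st²`

Toolkit (`--supports stmt-QuantumFields-24869 --as helper`) by the width prover `ym-line-frs-p3` (g2) of route
`ForcedResponseSkewness` (lead `ym-line-frs-p1`), for the free-model sanity of the contact kernel
(`…ResponseLocalisationGaussModel`, lead's WAKE ≈02:55Z target 2).  General centred Gaussian field `gaussianFieldOfKernel K`
of a positive semidefinite kernel (the tree's `B3WTFreeMeasure` Wick machinery, extended from order 4 to order 6):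

* `integral_pow_six_gaussianReal` — `∫ x⁶ dN(0,v) = 15 v³` (sixth derivative of the moment generating function);
* `integral_linF_pow_six` — `∫ L_c⁶ dμ_K = 15 G(c,c)³` for a finitely supported linear functional;
* `pow_four_mul_sq_eq_polar`, **`integral_linF_pow_four_mul_sq`** — by a seven-point polarisation
  `x⁴y² = −(49/540)x⁶ + (1/20)[(x±y)⁶] − (1/200)[(x±2y)⁶] + (1/2700)[(x±3y)⁶]`, the mixed sextic Wick moment
  `∫ L₁⁴ L₂² dμ_K = 3 G₁₁² G₂₂ + 12 G₁₁ G₁₂²`;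
* coordinate forms `integral_pow_four_mul_sq_eval`, `integral_pow_four_eval` (+ integrability companions);
* **`integral_centredSq_sq_mul_centredSq`** — `E[(ω_s² − K(s,s))² (ω_t² − K(t,t))] = 8 K(s,s) K(s,t)²`: the `x = z`
  (lattice-contact) value `8 C_xy C_yz C_zx|_{z=x}` of the third cumulant of Gaussian squares.

Pure Gaussian calculus; nothing about Yang–Mills is asserted and nothing here bears on the Yang–Mills mass gap.
Isserlis (1918); Janson, *Gaussian Hilbert Spaces* (1997) Thm 1.28 / Rem. 1.30. [folklore]
-/

set_option autoImplicit false

noncomputable section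

open MeasureTheory ProbabilityTheory
open Literature.MathematicalPhysics.QuantumFieldTheory Literature.MathematicalPhysics.QuantumLattice
open Literature.MathematicalPhysics.QuantumFieldTheory.Balaban1983to89.B3WTFreeMeasure
open Summit.QuantumFields.YangMills.Cruxes.SourcedPressureIncrement.Birth

namespace Summit.QuantumFields.YangMills.Cruxes.ResponseLocalisation.GaussModel

/-! ### §1 Sixth moments of Gaussian linear functionals and the mixed sextic Wick moment `E[L₁⁴L₂²]` -/

section Sextic

variable {ι : Type} [DecidableEq ι] {K : ι → ι → ℝ}

/-- calculus: `d/dt [P(t)e^{vt²/2}] = (P′(t) + P(t)vt)e^{vt²/2}`. [folklore] -/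
theorem deriv_mul_gauss₆ (v : ℝ) {P P' Q : ℝ → ℝ} (hP : ∀ t, HasDerivAt P (P' t) t)
    (hQ : ∀ t, P' t + P t * (v * t) = Q t) :
    deriv (fun t => P t * Real.exp (v * t ^ 2 / 2)) = fun t => Q t * Real.exp (v * t ^ 2 / 2) := by
  funext t
  have hg : HasDerivAt (fun t : ℝ => v * t ^ 2 / 2) (v * t) t := by
    have h := ((hasDerivAt_pow 2 t).const_mul v).div_const 2
    refine h.congr_deriv ?_
    push_cast
    ring
  have h : HasDerivAt (fun y : ℝ => P y * Real.exp (v * y ^ 2 / 2))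
      (P' t * Real.exp (v * t ^ 2 / 2) + P t * (Real.exp (v * t ^ 2 / 2) * (v * t))) t := (hP t).mul hg.exp
  rw [h.deriv, ← hQ t]
  ring

/-- **The sixth moment of a centred real Gaussian**: `∫ x⁶ dN(0,v) = 15 v³` (sixth derivative of the moment generating function
`e^{vt²/2}` at `0`; Janson Rem. 1.30: `E ξⁿ = (n−1)!! σⁿ`, `n = 6`). [folklore] -/
theorem integral_pow_six_gaussianReal (v : NNReal) : ∫ x, x ^ 6 ∂gaussianReal 0 v = 15 * (v : ℝ) ^ 3 := by
  have h6 := iteratedDeriv_mgf_zero (X := id) (μ := gaussianReal 0 v) (by simp) 6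
  have hR : ∫ x, (id ^ 6) x ∂gaussianReal 0 v = ∫ x, x ^ 6 ∂gaussianReal 0 v := by
    refine integral_congr_ae (ae_of_all _ fun x => ?_); simp
  rw [← hR, ← h6, mgf_id_gaussianReal]
  simp only [zero_mul, zero_add]
  set w : ℝ := (v : ℝ) with hw
  have d1 : deriv (fun t : ℝ => Real.exp (w * t ^ 2 / 2)) = fun t => (w * t) * Real.exp (w * t ^ 2 / 2) := by
    have h := deriv_mul_gauss₆ w (P := fun _ => (1 : ℝ)) (P' := fun _ => 0) (Q := fun t => w * t)
      (fun t => hasDerivAt_const t 1) (fun t => by ring)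
    simpa only [one_mul] using h
  have d2 : deriv (fun t : ℝ => (w * t) * Real.exp (w * t ^ 2 / 2)) =
      fun t => (w + w ^ 2 * t ^ 2) * Real.exp (w * t ^ 2 / 2) :=
    deriv_mul_gauss₆ w (P' := fun _ => w * 1) (fun t => (hasDerivAt_id' t).const_mul w) (fun t => by ring)
  have d3 : deriv (fun t : ℝ => (w + w ^ 2 * t ^ 2) * Real.exp (w * t ^ 2 / 2)) =
      fun t => (3 * w ^ 2 * t + w ^ 3 * t ^ 3) * Real.exp (w * t ^ 2 / 2) :=
    deriv_mul_gauss₆ w (P' := fun t => w ^ 2 * (↑(2 : ℕ) * t ^ (2 - 1)))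
      (fun t => ((hasDerivAt_pow 2 t).const_mul (w ^ 2)).const_add w) (fun t => by push_cast; ring)
  have d4 : deriv (fun t : ℝ => (3 * w ^ 2 * t + w ^ 3 * t ^ 3) * Real.exp (w * t ^ 2 / 2)) =
      fun t => (3 * w ^ 2 + 6 * w ^ 3 * t ^ 2 + w ^ 4 * t ^ 4) * Real.exp (w * t ^ 2 / 2) :=
    deriv_mul_gauss₆ w (P' := fun t => 3 * w ^ 2 * 1 + w ^ 3 * (↑(3 : ℕ) * t ^ (3 - 1)))
      (fun t => ((hasDerivAt_id' t).const_mul (3 * w ^ 2)).add ((hasDerivAt_pow 3 t).const_mul (w ^ 3)))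
      (fun t => by push_cast; ring)
  have d5 : deriv (fun t : ℝ => (3 * w ^ 2 + 6 * w ^ 3 * t ^ 2 + w ^ 4 * t ^ 4) * Real.exp (w * t ^ 2 / 2)) =
      fun t => (15 * w ^ 3 * t + 10 * w ^ 4 * t ^ 3 + w ^ 5 * t ^ 5) * Real.exp (w * t ^ 2 / 2) :=
    deriv_mul_gauss₆ w (P' := fun t => 0 + 6 * w ^ 3 * (↑(2 : ℕ) * t ^ (2 - 1)) + w ^ 4 * (↑(4 : ℕ) * t ^ (4 - 1)))
      (fun t => ((hasDerivAt_const t (3 * w ^ 2)).add ((hasDerivAt_pow 2 t).const_mul (6 * w ^ 3))).add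
        ((hasDerivAt_pow 4 t).const_mul (w ^ 4)))
      (fun t => by push_cast; ring)
  have d6 : deriv (fun t : ℝ => (15 * w ^ 3 * t + 10 * w ^ 4 * t ^ 3 + w ^ 5 * t ^ 5) * Real.exp (w * t ^ 2 / 2)) =
      fun t => (15 * w ^ 3 + 45 * w ^ 4 * t ^ 2 + 15 * w ^ 5 * t ^ 4 + w ^ 6 * t ^ 6) * Real.exp (w * t ^ 2 / 2) :=
    deriv_mul_gauss₆ w
      (P' := fun t => 15 * w ^ 3 * 1 + 10 * w ^ 4 * (↑(3 : ℕ) * t ^ (3 - 1)) + w ^ 5 * (↑(5 : ℕ) * t ^ (5 - 1)))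
      (fun t => (((hasDerivAt_id' t).const_mul (15 * w ^ 3)).add ((hasDerivAt_pow 3 t).const_mul (10 * w ^ 4))).add
        ((hasDerivAt_pow 5 t).const_mul (w ^ 5)))
      (fun t => by push_cast; ring)
  simp only [iteratedDeriv_succ, iteratedDeriv_zero]
  rw [d1, d2, d3, d4, d5, d6]
  simp

/-- the sixth power of a linear functional is integrable. [folklore] -/
theorem integrable_linF_pow_six (hK : IsPosSemidefKernel K) (S : Finset ι) (c : ι → ℝ) :
    Integrable (fun ω => linF S c ω ^ 6) (gaussianFieldOfKernel K) := by
  have h := (hasGaussianLaw_linF hK S c).memLp (p := ((6 : ℕ) : ENNReal)) (by norm_num)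
  refine (h.integrable_norm_pow (by norm_num)).congr (ae_of_all _ fun ω => ?_)
  simp only [Real.norm_eq_abs, pow_abs]
  exact abs_of_nonneg (by positivity)

/-- **The sixth moment of a centred Gaussian linear functional**: `∫ L_c⁶ dμ_K = 15 G(c,c)³`. [folklore] -/
theorem integral_linF_pow_six (hK : IsPosSemidefKernel K) (S : Finset ι) (c : ι → ℝ) :
    ∫ ω, linF S c ω ^ 6 ∂gaussianFieldOfKernel K = 15 * gram K S c c ^ 3 := by
  have hG := hasGaussianLaw_linF hK S c
  have hmap := hG.map_eq_gaussianReal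
  have h0 : ∫ ω, linF S c ω ∂gaussianFieldOfKernel K = 0 := integral_linF hK S c
  have hsq : ∫ ω, linF S c ω ^ 2 ∂gaussianFieldOfKernel K = gram K S c c := by
    rw [← integral_linF_mul_linF hK S c c]
    exact integral_congr_ae (ae_of_all _ fun ω => by ring)
  have hvar : Var[linF S c; gaussianFieldOfKernel K] = gram K S c c := by
    rw [variance_of_integral_eq_zero hG.aemeasurable h0, hsq]
  have hv0 : 0 ≤ gram K S c c := by
    rw [← hsq]
    exact integral_nonneg fun ω => sq_nonneg _
  have hm : ∫ ω, linF S c ω ^ 6 ∂gaussianFieldOfKernel K = ∫ x, x ^ 6 ∂(gaussianFieldOfKernel K).map (linF S c) := by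
    rw [integral_map hG.aemeasurable (by fun_prop)]
  rw [hm, hmap, h0, hvar, integral_pow_six_gaussianReal, Real.coe_toNNReal _ hv0]

/-- the Gram form along the pencil `c₁ + b c₂`. [folklore] -/
theorem gram_add_smul_self (hK : IsPosSemidefKernel K) (S : Finset ι) (c₁ c₂ : ι → ℝ) (b : ℝ) :
    gram K S (c₁ + b • c₂) (c₁ + b • c₂) = gram K S c₁ c₁ + 2 * b * gram K S c₁ c₂ + b * b * gram K S c₂ c₂ := by
  simp only [gram_add_left, gram_smul_left, gram_add_right hK, gram_smul_right hK]
  rw [gram_comm hK S c₂ c₁]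
  ring

omit [DecidableEq ι] in
/-- **Seven-point polarisation of `L₁⁴L₂²`**:
`x⁴y² = −(49/540)x⁶ + (1/20)[(x+y)⁶ + (x−y)⁶] − (1/200)[(x+2y)⁶ + (x−2y)⁶] + (1/2700)[(x+3y)⁶ + (x−3y)⁶]`. [folklore] -/
theorem pow_four_mul_sq_eq_polar (S : Finset ι) (c₁ c₂ : ι → ℝ) (ω : ι → ℝ) :
    linF S c₁ ω ^ 4 * linF S c₂ ω ^ 2 =
      -(49 / 540) * linF S (c₁ + (0 : ℝ) • c₂) ω ^ 6
        + (1 / 20) * (linF S (c₁ + (1 : ℝ) • c₂) ω ^ 6 + linF S (c₁ + (-1 : ℝ) • c₂) ω ^ 6)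
        - (1 / 200) * (linF S (c₁ + (2 : ℝ) • c₂) ω ^ 6 + linF S (c₁ + (-2 : ℝ) • c₂) ω ^ 6)
        + (1 / 2700) * (linF S (c₁ + (3 : ℝ) • c₂) ω ^ 6 + linF S (c₁ + (-3 : ℝ) • c₂) ω ^ 6) := by
  simp only [linF_add, linF_smul]
  ring

/-- **The mixed sextic Wick moment**: `∫ L₁⁴ L₂² dμ_K = 3 G₁₁² G₂₂ + 12 G₁₁ G₁₂²` (Isserlis for `n = 6` with the pairing
count `3·1 + 12`: three pairings inside `L₁⁴` times `G₂₂`, twelve pairings using two cross pairs). [folklore] -/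
theorem integral_linF_pow_four_mul_sq (hK : IsPosSemidefKernel K) (S : Finset ι) (c₁ c₂ : ι → ℝ) :
    ∫ ω, linF S c₁ ω ^ 4 * linF S c₂ ω ^ 2 ∂gaussianFieldOfKernel K =
      3 * gram K S c₁ c₁ ^ 2 * gram K S c₂ c₂ + 12 * gram K S c₁ c₁ * gram K S c₁ c₂ ^ 2 := by
  have I := fun b : ℝ => integrable_linF_pow_six hK S (c₁ + b • c₂)
  have F := fun b : ℝ => integral_linF_pow_six hK S (c₁ + b • c₂)
  have G := fun b : ℝ => gram_add_smul_self hK S c₁ c₂ b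
  simp_rw [pow_four_mul_sq_eq_polar S c₁ c₂]
  rw [integral_add, integral_sub, integral_add, integral_const_mul, integral_const_mul, integral_const_mul,
    integral_const_mul, integral_add, integral_add, integral_add, F, F, F, F, F, F, F, G, G, G, G, G, G, G]
  · ring
  · exact I _
  · exact I _
  · exact I _
  · exact I _
  · exact I _
  · exact I _
  · exact (I _).const_mul _
  · exact ((I _).add (I _)).const_mul _
  · exact ((I _).const_mul _).add (((I _).add (I _)).const_mul _)
  · exact ((I _).add (I _)).const_mul _
  · exact (((I _).const_mul _).add (((I _).add (I _)).const_mul _)).sub (((I _).add (I _)).const_mul _)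
  · exact ((I _).add (I _)).const_mul _

/-- integrability of `L₁⁴ L₂²`. [folklore] -/
theorem integrable_linF_pow_four_mul_sq (hK : IsPosSemidefKernel K) (S : Finset ι) (c₁ c₂ : ι → ℝ) :
    Integrable (fun ω => linF S c₁ ω ^ 4 * linF S c₂ ω ^ 2) (gaussianFieldOfKernel K) := by
  have I := fun b : ℝ => integrable_linF_pow_six hK S (c₁ + b • c₂)
  have e : (fun ω => linF S c₁ ω ^ 4 * linF S c₂ ω ^ 2) = fun ω =>
      -(49 / 540) * linF S (c₁ + (0 : ℝ) • c₂) ω ^ 6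
        + (1 / 20) * (linF S (c₁ + (1 : ℝ) • c₂) ω ^ 6 + linF S (c₁ + (-1 : ℝ) • c₂) ω ^ 6)
        - (1 / 200) * (linF S (c₁ + (2 : ℝ) • c₂) ω ^ 6 + linF S (c₁ + (-2 : ℝ) • c₂) ω ^ 6)
        + (1 / 2700) * (linF S (c₁ + (3 : ℝ) • c₂) ω ^ 6 + linF S (c₁ + (-3 : ℝ) • c₂) ω ^ 6) :=
    funext fun ω => pow_four_mul_sq_eq_polar S c₁ c₂ ω
  rw [e]
  exact ((((I _).const_mul _).add (((I _).add (I _)).const_mul _)).sub (((I _).add (I _)).const_mul _)).add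
    (((I _).add (I _)).const_mul _)

/-- the coordinate `ω s` as the indicator linear functional on `{s, t}` (fourth power form). [folklore] -/
theorem eval_eq_linF_left (s t : ι) (ω : ι → ℝ) : ω s = linF {s, t} (fun i => if i = s then (1 : ℝ) else 0) ω := by
  simp [linF, ite_mul, Finset.sum_ite_eq']

/-- the coordinate `ω t` as the indicator linear functional on `{s, t}`. [folklore] -/
theorem eval_eq_linF_right (s t : ι) (ω : ι → ℝ) : ω t = linF {s, t} (fun i => if i = t then (1 : ℝ) else 0) ω := by
  simp [linF, ite_mul, Finset.sum_ite_eq']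

/-- **`E[ω_s⁴ ω_t²] = 3 K(s,s)² K(t,t) + 12 K(s,s) K(s,t)²`** (the mixed sextic Wick moment for two coordinates). [folklore] -/
theorem integral_pow_four_mul_sq_eval (hK : IsPosSemidefKernel K) (s t : ι) :
    ∫ ω, ω s ^ 4 * ω t ^ 2 ∂gaussianFieldOfKernel K = 3 * K s s ^ 2 * K t t + 12 * K s s * K s t ^ 2 := by
  have hs : s ∈ ({s, t} : Finset ι) := by simp
  have ht : t ∈ ({s, t} : Finset ι) := by simp
  have h := integral_linF_pow_four_mul_sq hK {s, t} (fun i => if i = s then (1 : ℝ) else 0)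
    (fun i => if i = t then (1 : ℝ) else 0)
  rw [gram_pair_indicator s t hs hs,
    gram_pair_indicator s t ht ht,
    gram_pair_indicator s t hs ht] at h
  have e : ∀ ω : ι → ℝ, ω s ^ 4 * ω t ^ 2 =
      linF {s, t} (fun i => if i = s then (1 : ℝ) else 0) ω ^ 4 *
        linF {s, t} (fun i => if i = t then (1 : ℝ) else 0) ω ^ 2 := fun ω => by
    rw [← eval_eq_linF_left s t ω, ← eval_eq_linF_right s t ω]
  simp_rw [e]
  exact h

/-- integrability companion of `integral_pow_four_mul_sq_eval`. [folklore] -/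
theorem integrable_pow_four_mul_sq_eval (hK : IsPosSemidefKernel K) (s t : ι) :
    Integrable (fun ω : ι → ℝ => ω s ^ 4 * ω t ^ 2) (gaussianFieldOfKernel K) := by
  have h := integrable_linF_pow_four_mul_sq hK {s, t} (fun i => if i = s then (1 : ℝ) else 0)
    (fun i => if i = t then (1 : ℝ) else 0)
  have e : (fun ω : ι → ℝ => ω s ^ 4 * ω t ^ 2) = fun ω =>
      linF {s, t} (fun i => if i = s then (1 : ℝ) else 0) ω ^ 4 *
        linF {s, t} (fun i => if i = t then (1 : ℝ) else 0) ω ^ 2 := funext fun ω => by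
    rw [← eval_eq_linF_left s t ω, ← eval_eq_linF_right s t ω]
  rw [e]
  exact h

/-- `E[ω_s⁴] = 3 K(s,s)²`. [folklore] -/
theorem integral_pow_four_eval (hK : IsPosSemidefKernel K) (s t : ι) :
    ∫ ω, ω s ^ 4 ∂gaussianFieldOfKernel K = 3 * K s s ^ 2 := by
  have hs : s ∈ ({s, t} : Finset ι) := by simp
  have h := integral_linF_pow_four hK {s, t} (fun i => if i = s then (1 : ℝ) else 0)
  rw [gram_pair_indicator s t hs hs] at h
  have e : ∀ ω : ι → ℝ, ω s ^ 4 = linF {s, t} (fun i => if i = s then (1 : ℝ) else 0) ω ^ 4 := fun ω => by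
    rw [← eval_eq_linF_left s t ω]
  simp_rw [e]
  exact h

/-- integrability of `ω_s⁴`. [folklore] -/
theorem integrable_pow_four_eval (hK : IsPosSemidefKernel K) (s t : ι) :
    Integrable (fun ω : ι → ℝ => ω s ^ 4) (gaussianFieldOfKernel K) := by
  have h := integrable_linF_pow_four hK {s, t} (fun i => if i = s then (1 : ℝ) else 0)
  have e : (fun ω : ι → ℝ => ω s ^ 4) = fun ω => linF {s, t} (fun i => if i = s then (1 : ℝ) else 0) ω ^ 4 :=
    funext fun ω => by rw [← eval_eq_linF_left s t ω]
  rw [e]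
  exact h

/-! ### §2 The free lattice-contact term: `E[(X² − K_ss)² (Y² − K_tt)] = 8 K_ss K_st²` -/

/-- **Isserlis for a squared centred square against a centred square**: for two coordinates `X = ω_s`, `Y = ω_t` of the
centred Gaussian field of kernel `K`, `E[(X² − K(s,s))² (Y² − K(t,t))] = 8 K(s,s) K(s,t)²` — the `x = z` (lattice-contact)
value `8 C_xy C_yz C_zx|_{z = x}` of the third cumulant of Gaussian squares. [folklore] -/
theorem integral_centredSq_sq_mul_centredSq (hK : IsPosSemidefKernel K) (s t : ι) {a b : ℝ}
    (ha : K s s = a) (hb : K t t = b) :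
    ∫ ω, (ω s ^ 2 - a) ^ 2 * (ω t ^ 2 - b) ∂gaussianFieldOfKernel K = 8 * a * K s t ^ 2 := by
  haveI := isProbabilityMeasure_gaussianFieldOfKernel hK
  have e : ∀ ω : ι → ℝ, (ω s ^ 2 - a) ^ 2 * (ω t ^ 2 - b) =
      ((ω s ^ 4 * ω t ^ 2 - b * ω s ^ 4) - (2 * a * (ω s ^ 2 * ω t ^ 2) - 2 * a * b * ω s ^ 2))
        + (a ^ 2 * ω t ^ 2 - a ^ 2 * b) := fun ω => by ring
  have i1 := integrable_pow_four_mul_sq_eval hK s t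
  have i2 : Integrable (fun ω : ι → ℝ => b * ω s ^ 4) (gaussianFieldOfKernel K) := (integrable_pow_four_eval hK s t).const_mul b
  have i3 : Integrable (fun ω : ι → ℝ => 2 * a * (ω s ^ 2 * ω t ^ 2)) (gaussianFieldOfKernel K) :=
    (integrable_sq_mul_sq hK s t).const_mul _
  have i4 : Integrable (fun ω : ι → ℝ => 2 * a * b * ω s ^ 2) (gaussianFieldOfKernel K) :=
    (integrable_sq hK s).const_mul _
  have i5 : Integrable (fun ω : ι → ℝ => a ^ 2 * ω t ^ 2) (gaussianFieldOfKernel K) :=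
    (integrable_sq hK t).const_mul _
  have i6 : Integrable (fun _ : ι → ℝ => a ^ 2 * b) (gaussianFieldOfKernel K) := integrable_const _
  have i12 : Integrable (fun ω : ι → ℝ => ω s ^ 4 * ω t ^ 2 - b * ω s ^ 4) (gaussianFieldOfKernel K) := i1.sub i2
  have i34 : Integrable (fun ω : ι → ℝ => 2 * a * (ω s ^ 2 * ω t ^ 2) - 2 * a * b * ω s ^ 2)
      (gaussianFieldOfKernel K) := i3.sub i4
  have i56 : Integrable (fun ω : ι → ℝ => a ^ 2 * ω t ^ 2 - a ^ 2 * b) (gaussianFieldOfKernel K) := i5.sub i6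
  have i1234 : Integrable (fun ω : ι → ℝ => (ω s ^ 4 * ω t ^ 2 - b * ω s ^ 4) -
      (2 * a * (ω s ^ 2 * ω t ^ 2) - 2 * a * b * ω s ^ 2)) (gaussianFieldOfKernel K) := i12.sub i34
  simp_rw [e]
  rw [integral_add i1234 i56, integral_sub i12 i34, integral_sub i1 i2, integral_sub i3 i4, integral_sub i5 i6,
    integral_const_mul, integral_const_mul, integral_const_mul, integral_const_mul, integral_const, probReal_univ,
    one_smul, integral_pow_four_mul_sq_eval hK, integral_pow_four_eval hK s t, integral_sq_mul_sq hK, integral_sq hK,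
    integral_sq hK, ha, hb]
  ring

end Sextic

end Summit.QuantumFields.YangMills.Cruxes.ResponseLocalisation.GaussModel

end
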